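import Summits.AtomisticToContinuum.Crystallization.Theses.SquareWellLayerCake
import Summits.AtomisticToContinuum.Crystallization.Theorems.SquareWellLayerCakeGapTwelveToBarlowNoSixCommonNeighbours
import Summits.AtomisticToContinuum.Crystallization.Theorems.SquareWellLayerCakeGapTwelveToBarlowSubconfigurationFloor
import Summits.AtomisticToContinuum.Crystallization.Theorems.SquareWellLayerCakeGapTwelveToBarlowLocalisation
import Summits.AtomisticToContinuum.Crystallization.Theorems.SquareWellLayerCakeGapTwelveToBarlowFiveFoldStub

/-!
# Skeleton v2 — crux `SquareWellLayerCake.GapTwelveToBarlow` (stmt-AtomisticToContinuum-15807), line `Sketch`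

Lead-owned skeleton built on the vocabulary of `Cruxes/GapTwelveToBarlow/SketchIdeator1.lean`.
The crux (a.e. Good sites in Lennard-Jones ground states ⇒ a.e. `R`-window `ε`-matched to a
window of SOME Barlow stacking, for every `R`, `ε`) is composed from stubs stated in tree
vocabulary only (Mathlib + `Literature.…StatisticalMechanics`), so that a worker's landed theorem is
LITERALLY the registered signature.

CLOSED (landed, wave 1):
* `stub_noSixCommonNeighbours` — sign lemma of card A (p129567);
* `stub_subconfigurationFloor` — `|S|·e*` floor of card B (p128963);
* `stub_localisation` — a.e. Good ⇒ ∀ D, a.e. all-Good `D`-ball (p129122);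
* the counting reduction `stub_fiveFoldSparsity_of_noHoles_of_subcubic` (p130314, p130647, p131100),
  by which `stub_fiveFoldSparsity` is now DERIVED from two geometric stubs.

OPEN (v2):
* `stub_noHoles` (M/L) — an all-Good region has `≥ c·D³` sites in a `D`-ball (no big voids).
* `stub_extendedGap` (M–XL; the ZOO statement, "tolerant Lemma 2") — four-deep inside an all-Good
  region no two sites are at distance in `(1, 1.31)`: every cell is a near-regular tetrahedron or
  octahedron; with it `card = 5` common neighbours ⇔ a CLOSED five-tetrahedra ring (`+Ω`).
* `stub_fiveFoldSubcubic` (XL; card A proper, = card `cbb-curvature-ration`) — given the extended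
  gap, five-fold sites in an all-Good `D`-ball number `≤ ε·D³` for `D` large (curvature ration).
* `stub_relaxedRigidity` (XL; card B, strain half — LEAD) — ground states, a.e. all-Good balls,
  a.e. five-fold-free, extended gap, floor ⇒ a.e. window `ε`-matched to a RELAXED LAYERED template
  (triangular layers of spacing `a`, Hägg-coded hole positions, FREE interlayer spacings `z`, the
  format of `HullMinimality.LayeredWindows` stmt-11778).
* `stub_uniformSpacing` (XL; card B, the hidden SELECTION half made explicit — B4 /
  `K3UniformSpacingNoteIdeator2.md` / disprover's `not_matched_of_gap_jump`) — ground states whose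
  windows are a.e. relaxed-layered-matched at every `(R, ε)` are a.e. matched to UNIFORM-gap
  Barlow templates `barlowStacking a h s` at every `(R, ε)` (fault-area and inequivalent-gap
  polytype density `→ 0`: Hägg-domination-type selection at the `1e-4` energy scale).

DERIVED: `stub_fiveFoldSparsity`, `stub_pricedRigidity`, and the composition `GapTwelveToBarlow_of`
(sorries only in the five open `stub_*`).
-/

noncomputable section

namespace Summit.AtomisticToContinuum.Crystallization.Cruxes.GapTwelveToBarlow.Sketch

open Literature.MathematicalPhysics.StatisticalMechanics
open Summit.AtomisticToContinuum.Crystallization.Theses.SquareWellLayerCake (GapTwelveToBarlow)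
open Summit.AtomisticToContinuum.Crystallization.Theorems

/-- Ambient space `ℝ³`. -/
abbrev E3 := EuclideanSpace ℝ (Fin 3)

/-! ## The crux's own predicates, named (verbatim) — documentation and `crux_iff` only -/

/-- The hypothesis predicate of the crux at site `i` (verbatim): the `11/10`-neighbourhood of `x i`
is `55/57`-separated from everything, exactly twelve other particles within distance `1`, at most
twelve within `11/10`. -/
def Good {N : ℕ} (x : Fin N → E3) (i : Fin N) : Prop :=
  (∀ j : Fin N, dist (x i) (x j) ≤ 11 / 10 → ∀ k : Fin N, k ≠ j → (55 : ℝ) / 57 ≤ dist (x j) (x k)) ∧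
  (Finset.univ.filter fun j : Fin N => j ≠ i ∧ dist (x i) (x j) ≤ 1).card = 12 ∧
  (Finset.univ.filter fun j : Fin N => j ≠ i ∧ dist (x i) (x j) ≤ 11 / 10).card ≤ 12

/-- The conclusion predicate of the crux at site `i` (verbatim): the `R`-window of `x i` is two-way
`ε`-matched, after a linear isometry `A`, to the `R`-window of a point `z` of some Barlow stacking
`barlowStacking a h s` (`a, h ∈ (1/2, 2)`, `s` a Hägg sequence). -/
def BarlowMatched {N : ℕ} (R ε : ℝ) (x : Fin N → E3) (i : Fin N) : Prop :=
  ∃ a h : ℝ, 1 / 2 < a ∧ a < 2 ∧ 1 / 2 < h ∧ h < 2 ∧ ∃ s : ℤ → ℤ, IsHaggSeq s ∧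
    ∃ z ∈ barlowStacking a h s, ∃ A : E3 →ₗᵢ[ℝ] E3,
      (∀ p ∈ barlowStacking a h s, dist p z ≤ R → ∃ j : Fin N, dist (x j) (x i + A (p - z)) ≤ ε) ∧
      (∀ j : Fin N, dist (x j) (x i) ≤ R → ∃ p ∈ barlowStacking a h s, dist (x j) (x i + A (p - z)) ≤ ε)

/-- Every site within distance `D` of `x i` (including `i`) is Good. -/
def AllGoodBall {N : ℕ} (D : ℝ) (x : Fin N → E3) (i : Fin N) : Prop :=
  ∀ j : Fin N, dist (x i) (x j) ≤ D → Good x j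

/-- A FIVE-FOLD BOND (card A): a bonded pair (`i ≠ j`, distance `≤ 1`) with exactly five common
neighbours within distance `1` (under `stub_extendedGap`: the closed ring of five tetrahedra). -/
def FiveFold {N : ℕ} (x : Fin N → E3) (i j : Fin N) : Prop :=
  i ≠ j ∧ dist (x i) (x j) ≤ 1 ∧
    (Finset.univ.filter fun k : Fin N =>
      k ≠ i ∧ k ≠ j ∧ dist (x i) (x k) ≤ 1 ∧ dist (x j) (x k) ≤ 1).card = 5

/-- The RELAXED LAYERED template (format of `HullMinimality.LayeredWindows`, stmt-11778): triangular
layers of spacing `a`, consecutive layers in distinct hole positions coded by `haggLabel s`, FREE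
layer heights `z m`. -/
def layeredPos (a : ℝ) (s : ℤ → ℤ) (z : ℤ → ℝ) (m i j : ℤ) : E3 :=
  (i : ℝ) • triangularVec₁ a + (j : ℝ) • triangularVec₂ a +
    (haggLabel s m : ℝ) • barlowOffset a + z m • layerNormal 1

/-- The `R`-window of `x i` is two-way `ε`-matched, after a linear isometry, to the `R`-window of a
point `p₀` of some relaxed layered template (`a ∈ [47/50, 1]`, increments of `z` in
`[39a/50, 17a/20]`). -/
def RelaxedMatched {N : ℕ} (R ε : ℝ) (x : Fin N → E3) (i : Fin N) : Prop :=
  ∃ a : ℝ, 47 / 50 ≤ a ∧ a ≤ 1 ∧ ∃ s : ℤ → ℤ, IsHaggSeq s ∧ ∃ z : ℤ → ℝ,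
    (∀ m : ℤ, 39 / 50 * a ≤ z (m + 1) - z m ∧ z (m + 1) - z m ≤ 17 / 20 * a) ∧
    ∃ m₀ i₀ j₀ : ℤ, ∃ A : E3 →ₗᵢ[ℝ] E3,
      (∀ m i' j' : ℤ, dist (layeredPos a s z m i' j') (layeredPos a s z m₀ i₀ j₀) ≤ R →
        ∃ j : Fin N, dist (x j) (x i + A (layeredPos a s z m i' j' - layeredPos a s z m₀ i₀ j₀)) ≤ ε) ∧
      (∀ j : Fin N, dist (x j) (x i) ≤ R → ∃ m i' j' : ℤ,
        dist (x j) (x i + A (layeredPos a s z m i' j' - layeredPos a s z m₀ i₀ j₀)) ≤ ε)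

/-- **The crux, restated through the named predicates** (definitional unfolding, `Iff.rfl`). -/
theorem crux_iff :
    GapTwelveToBarlow ↔
      ∀ x : (N : ℕ) → (Fin N → E3), (∀ N, IsGroundState lennardJones (x N)) →
        Filter.Tendsto (fun N : ℕ => (Nat.card {i : Fin N // ¬ Good (x N) i} : ℝ) / N)
          Filter.atTop (nhds 0) →
        ∀ R ε : ℝ, 0 < R → 0 < ε → ε < 1 / 4 →
          Filter.Tendsto (fun N : ℕ => (Nat.card {i : Fin N // ¬ BarlowMatched R ε (x N) i} : ℝ) / N)
            Filter.atTop (nhds 0) :=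
  Iff.rfl

/-- Sanity (the structural fact behind `stub_localisation`): a Good site is itself
`55/57`-separated from every other site, so Good sites form a packing. -/
theorem good_separated {N : ℕ} {x : Fin N → E3} {i : Fin N} (h : Good x i) :
    ∀ k : Fin N, k ≠ i → (55 : ℝ) / 57 ≤ dist (x i) (x k) :=
  h.1 i (by rw [dist_self]; norm_num)

/-! ## Closed stubs (landed in `Theorems/SquareWellLayerCakeGapTwelveToBarlow*.lean`) -/

/-- Stub (card A, SIGN LEMMA; CLOSED p129567): among points pairwise `≥ 55/57` apart, a bonded pair
(distance `≤ 1`) has at most five common neighbours within distance `1`. -/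
theorem stub_noSixCommonNeighbours :
    ∀ (N : ℕ) (x : Fin N → EuclideanSpace ℝ (Fin 3)) (i j : Fin N), i ≠ j →
      (∀ k l : Fin N, k ≠ l → (55 : ℝ) / 57 ≤ dist (x k) (x l)) → dist (x i) (x j) ≤ 1 →
      (Finset.univ.filter fun k : Fin N =>
        k ≠ i ∧ k ≠ j ∧ dist (x i) (x k) ≤ 1 ∧ dist (x j) (x k) ≤ 1).card ≤ 5 :=
  SquareWellLayerCakeGapTwelveToBarlow.stub_noSixCommonNeighbours

/-- Stub (card B, SUB-CONFIGURATION FLOOR; CLOSED p128963): every sub-configuration `S` of an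
injective configuration has Lennard-Jones energy at least `|S|·e*`, `e* = ⨅_Q e(Q)`. -/
theorem stub_subconfigurationFloor :
    ∀ (N : ℕ) (x : Fin N → EuclideanSpace ℝ (Fin 3)), Function.Injective x → ∀ S : Finset (Fin N),
      (S.card : ℝ) * (⨅ Q : PeriodicConfiguration 3, Q.energyPerParticle lennardJones) ≤
        ∑ i ∈ S, ∑ j ∈ S, if i < j then lennardJones (dist (x i) (x j)) else 0 :=
  SquareWellLayerCakeGapTwelveToBarlow.stub_subconfigurationFloor

/-- Stub (glue, LOCALISATION; CLOSED p129122): along any sequence of configurations with a.e. Good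
sites, for every radius `D > 0` a.e. site has an all-Good `D`-ball. -/
theorem stub_localisation :
    ∀ x : (N : ℕ) → (Fin N → EuclideanSpace ℝ (Fin 3)),
      Filter.Tendsto (fun N : ℕ => (Nat.card {i : Fin N // ¬ (
          (∀ j : Fin N, dist (x N i) (x N j) ≤ 11 / 10 → ∀ k : Fin N, k ≠ j → (55 : ℝ) / 57 ≤ dist (x N j) (x N k)) ∧
          (Finset.univ.filter fun j : Fin N => j ≠ i ∧ dist (x N i) (x N j) ≤ 1).card = 12 ∧
          (Finset.univ.filter fun j : Fin N => j ≠ i ∧ dist (x N i) (x N j) ≤ 11 / 10).card ≤ 12)} : ℝ) / N)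
        Filter.atTop (nhds 0) →
      ∀ D : ℝ, 0 < D →
        Filter.Tendsto (fun N : ℕ => (Nat.card {i : Fin N // ¬ (∀ j : Fin N, dist (x N i) (x N j) ≤ D →
          ((∀ j' : Fin N, dist (x N j) (x N j') ≤ 11 / 10 → ∀ k : Fin N, k ≠ j' → (55 : ℝ) / 57 ≤ dist (x N j') (x N k)) ∧
          (Finset.univ.filter fun j' : Fin N => j' ≠ j ∧ dist (x N j) (x N j') ≤ 1).card = 12 ∧
          (Finset.univ.filter fun j' : Fin N => j' ≠ j ∧ dist (x N j) (x N j') ≤ 11 / 10).card ≤ 12))} : ℝ) / N)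
          Filter.atTop (nhds 0) :=
  SquareWellLayerCakeGapTwelveToBarlow.stub_localisation

/-! ## Open stubs — card A (geometry, energy-free) -/

/-- Stub (card A, NO HOLES; M/L): there are `c > 0` and `D₀` such that every site whose `2D`-ball is
all-Good (`D ≥ D₀`) has at least `c·D³` sites within distance `D` (an all-Good region has no void
of radius `ρ₀`: covering radius of an admissible 12-shell `< 90°`, greedy descent walk, disjoint
balls). -/
theorem stub_noHoles :
    ∃ c : ℝ, 0 < c ∧ ∃ D₀ : ℝ, ∀ (N : ℕ) (x : Fin N → EuclideanSpace ℝ (Fin 3))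
      (i : Fin N) (D : ℝ), D₀ ≤ D →
      (∀ j : Fin N, dist (x i) (x j) ≤ 2 * D →
        ((∀ j' : Fin N, dist (x j) (x j') ≤ 11 / 10 → ∀ k : Fin N, k ≠ j' →
            (55 : ℝ) / 57 ≤ dist (x j') (x k)) ∧
          (Finset.univ.filter fun j' : Fin N => j' ≠ j ∧ dist (x j) (x j') ≤ 1).card = 12 ∧
          (Finset.univ.filter fun j' : Fin N => j' ≠ j ∧ dist (x j) (x j') ≤ 11 / 10).card ≤ 12)) →
      c * D ^ 3 ≤ (Finset.univ.filter fun j : Fin N => dist (x i) (x j) ≤ D).card := by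
  sorry

/-- Stub (card A, EXTENDED GAP = tolerant Lemma 2, the ZOO statement; M–XL, adversarially the
weakest point of the line): four-deep inside an all-Good region no two sites are at distance in
`(1, 131/100)` — every Delaunay cell is a near-regular tetrahedron or octahedron (octahedron
diagonals `≥ √(4·((55/57)² − 1/2)) = 1.313` is elementary; excluding every other motif — stretched
pentagonal-bipyramid voids, slivers, a 13th site at `1.1–1.31` — is the content). -/
theorem stub_extendedGap :
    ∀ (N : ℕ) (x : Fin N → EuclideanSpace ℝ (Fin 3)) (i j : Fin N),
      (∀ l : Fin N, dist (x i) (x l) ≤ 4 →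
        ((∀ j' : Fin N, dist (x l) (x j') ≤ 11 / 10 → ∀ k : Fin N, k ≠ j' →
            (55 : ℝ) / 57 ≤ dist (x j') (x k)) ∧
          (Finset.univ.filter fun j' : Fin N => j' ≠ l ∧ dist (x l) (x j') ≤ 1).card = 12 ∧
          (Finset.univ.filter fun j' : Fin N => j' ≠ l ∧ dist (x l) (x j') ≤ 11 / 10).card ≤ 12)) →
      1 < dist (x i) (x j) → (131 : ℝ) / 100 ≤ dist (x i) (x j) := by
  sorry

/-- Stub (card A proper, SUB-CUBIC FIVE-FOLD COUNT given the extended gap; XL — the cone-deficit /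
curvature-ration mechanism of cards `cone-deficit-fivefold-sparsity` and `cbb-curvature-ration`):
for every `ε > 0` and `D₁` there is `D ≥ D₁` such that every site with an all-Good `2D`-ball has at
most `ε·D³` sites within `D` carrying a five-fold bond (linear growth `≤ C·D` is expected). -/
theorem stub_fiveFoldSubcubic :
    (∀ (N : ℕ) (x : Fin N → EuclideanSpace ℝ (Fin 3)) (i j : Fin N),
      (∀ l : Fin N, dist (x i) (x l) ≤ 4 →
        ((∀ j' : Fin N, dist (x l) (x j') ≤ 11 / 10 → ∀ k : Fin N, k ≠ j' →
            (55 : ℝ) / 57 ≤ dist (x j') (x k)) ∧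
          (Finset.univ.filter fun j' : Fin N => j' ≠ l ∧ dist (x l) (x j') ≤ 1).card = 12 ∧
          (Finset.univ.filter fun j' : Fin N => j' ≠ l ∧ dist (x l) (x j') ≤ 11 / 10).card ≤ 12)) →
      1 < dist (x i) (x j) → (131 : ℝ) / 100 ≤ dist (x i) (x j)) →
    ∀ ε : ℝ, 0 < ε → ∀ D₁ : ℝ, ∃ D : ℝ, D₁ ≤ D ∧
      ∀ (N : ℕ) (x : Fin N → EuclideanSpace ℝ (Fin 3)) (i : Fin N),
      (∀ j : Fin N, dist (x i) (x j) ≤ 2 * D →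
        ((∀ j' : Fin N, dist (x j) (x j') ≤ 11 / 10 → ∀ k : Fin N, k ≠ j' →
            (55 : ℝ) / 57 ≤ dist (x j') (x k)) ∧
          (Finset.univ.filter fun j' : Fin N => j' ≠ j ∧ dist (x j) (x j') ≤ 1).card = 12 ∧
          (Finset.univ.filter fun j' : Fin N => j' ≠ j ∧ dist (x j) (x j') ≤ 11 / 10).card ≤ 12)) →
      ((Finset.univ.filter fun j : Fin N => dist (x i) (x j) ≤ D ∧
          ∃ k : Fin N, j ≠ k ∧ dist (x j) (x k) ≤ 1 ∧
            (Finset.univ.filter fun l : Fin N =>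
              l ≠ j ∧ l ≠ k ∧ dist (x j) (x l) ≤ 1 ∧ dist (x k) (x l) ≤ 1).card = 5).card : ℝ) ≤
        ε * D ^ 3 := by
  sorry

/-- DERIVED (card A's output): the sign lemma ⇒ along any sequence of configurations (no
minimality) with a.e. Good sites, for every `R > 0` the fraction of sites having a five-fold bond
within distance `R` tends to zero — from `stub_noHoles`, `stub_fiveFoldSubcubic stub_extendedGap`
and the landed counting reduction `stub_fiveFoldSparsity_of_noHoles_of_subcubic`. -/
theorem stub_fiveFoldSparsity :
    (∀ (N : ℕ) (x : Fin N → EuclideanSpace ℝ (Fin 3)) (i j : Fin N), i ≠ j →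
      (∀ k l : Fin N, k ≠ l → (55 : ℝ) / 57 ≤ dist (x k) (x l)) → dist (x i) (x j) ≤ 1 →
      (Finset.univ.filter fun k : Fin N =>
        k ≠ i ∧ k ≠ j ∧ dist (x i) (x k) ≤ 1 ∧ dist (x j) (x k) ≤ 1).card ≤ 5) →
    ∀ x : (N : ℕ) → (Fin N → EuclideanSpace ℝ (Fin 3)),
      Filter.Tendsto (fun N : ℕ => (Nat.card {i : Fin N // ¬ (
          (∀ j : Fin N, dist (x N i) (x N j) ≤ 11 / 10 → ∀ k : Fin N, k ≠ j → (55 : ℝ) / 57 ≤ dist (x N j) (x N k)) ∧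
          (Finset.univ.filter fun j : Fin N => j ≠ i ∧ dist (x N i) (x N j) ≤ 1).card = 12 ∧
          (Finset.univ.filter fun j : Fin N => j ≠ i ∧ dist (x N i) (x N j) ≤ 11 / 10).card ≤ 12)} : ℝ) / N)
        Filter.atTop (nhds 0) →
      ∀ R : ℝ, 0 < R →
        Filter.Tendsto (fun N : ℕ => (Nat.card {i : Fin N // ∃ j k : Fin N,
          (j ≠ k ∧ dist (x N j) (x N k) ≤ 1 ∧
            (Finset.univ.filter fun l : Fin N =>
              l ≠ j ∧ l ≠ k ∧ dist (x N j) (x N l) ≤ 1 ∧ dist (x N k) (x N l) ≤ 1).card = 5) ∧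
          dist (x N i) (x N j) ≤ R} : ℝ) / N)
          Filter.atTop (nhds 0) :=
  SquareWellLayerCakeGapTwelveToBarlow.stub_fiveFoldSparsity_of_noHoles_of_subcubic
    stub_noHoles (stub_fiveFoldSubcubic stub_extendedGap)

/-! ## Open stubs — card B (energetic; minimality is spent here and only here) -/

/-- Stub (card B, RELAXED RIGIDITY = the STRAIN half; XL — LEAD): the extended gap and the floor ⇒
for every sequence of Lennard-Jones ground states in which, for every `D`, a.e. site has an
all-Good `D`-ball and, for every `R`, a.e. site has no five-fold bond within `R`, the `R`-window of
a.e. site is two-way `ε`-matched, after a linear isometry, to a window of a RELAXED LAYERED template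
(triangular layers of spacing `a ∈ [47/50, 1]`, Hägg-coded hole positions, FREE interlayer spacings
with increments in `[39a/50, 17a/20]`), for every `R > 0`, `ε ∈ (0, 1/4)`.  Mechanism (card
`estar-absorbing-priced-pieces`): combinatorial Barlow charts on five-fold-free all-Good T/O regions,
a priced perturbative inequality (Cauchy–Born coercivity about the relaxed layered family + John's
rotation-and-strain lemma), the budget `N·e* ≤ E(N) = N·e* + o(N)`. -/
theorem stub_relaxedRigidity :
    (∀ (N : ℕ) (x : Fin N → EuclideanSpace ℝ (Fin 3)) (i j : Fin N),
      (∀ l : Fin N, dist (x i) (x l) ≤ 4 →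
        ((∀ j' : Fin N, dist (x l) (x j') ≤ 11 / 10 → ∀ k : Fin N, k ≠ j' →
            (55 : ℝ) / 57 ≤ dist (x j') (x k)) ∧
          (Finset.univ.filter fun j' : Fin N => j' ≠ l ∧ dist (x l) (x j') ≤ 1).card = 12 ∧
          (Finset.univ.filter fun j' : Fin N => j' ≠ l ∧ dist (x l) (x j') ≤ 11 / 10).card ≤ 12)) →
      1 < dist (x i) (x j) → (131 : ℝ) / 100 ≤ dist (x i) (x j)) →
    (∀ (N : ℕ) (x : Fin N → EuclideanSpace ℝ (Fin 3)), Function.Injective x → ∀ S : Finset (Fin N),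
      (S.card : ℝ) * (⨅ Q : PeriodicConfiguration 3, Q.energyPerParticle lennardJones) ≤
        ∑ i ∈ S, ∑ j ∈ S, if i < j then lennardJones (dist (x i) (x j)) else 0) →
    ∀ x : (N : ℕ) → (Fin N → EuclideanSpace ℝ (Fin 3)),
      (∀ N, IsGroundState lennardJones (x N)) →
      (∀ D : ℝ, 0 < D →
        Filter.Tendsto (fun N : ℕ => (Nat.card {i : Fin N // ¬ (∀ j : Fin N, dist (x N i) (x N j) ≤ D →
          ((∀ j' : Fin N, dist (x N j) (x N j') ≤ 11 / 10 → ∀ k : Fin N, k ≠ j' → (55 : ℝ) / 57 ≤ dist (x N j') (x N k)) ∧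
          (Finset.univ.filter fun j' : Fin N => j' ≠ j ∧ dist (x N j) (x N j') ≤ 1).card = 12 ∧
          (Finset.univ.filter fun j' : Fin N => j' ≠ j ∧ dist (x N j) (x N j') ≤ 11 / 10).card ≤ 12))} : ℝ) / N)
          Filter.atTop (nhds 0)) →
      (∀ R : ℝ, 0 < R →
        Filter.Tendsto (fun N : ℕ => (Nat.card {i : Fin N // ∃ j k : Fin N,
          (j ≠ k ∧ dist (x N j) (x N k) ≤ 1 ∧
            (Finset.univ.filter fun l : Fin N =>
              l ≠ j ∧ l ≠ k ∧ dist (x N j) (x N l) ≤ 1 ∧ dist (x N k) (x N l) ≤ 1).card = 5) ∧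
          dist (x N i) (x N j) ≤ R} : ℝ) / N)
          Filter.atTop (nhds 0)) →
      ∀ R ε : ℝ, 0 < R → 0 < ε → ε < 1 / 4 →
        Filter.Tendsto (fun N : ℕ => (Nat.card {i : Fin N // ¬ (∃ a : ℝ, 47 / 50 ≤ a ∧ a ≤ 1 ∧
          ∃ s : ℤ → ℤ, IsHaggSeq s ∧ ∃ z : ℤ → ℝ,
            (∀ m : ℤ, 39 / 50 * a ≤ z (m + 1) - z m ∧ z (m + 1) - z m ≤ 17 / 20 * a) ∧
            ∃ m₀ i₀ j₀ : ℤ, ∃ A : EuclideanSpace ℝ (Fin 3) →ₗᵢ[ℝ] EuclideanSpace ℝ (Fin 3),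
              (∀ m i' j' : ℤ,
                dist ((i' : ℝ) • triangularVec₁ a + (j' : ℝ) • triangularVec₂ a +
                    (haggLabel s m : ℝ) • barlowOffset a + z m • layerNormal 1)
                  ((i₀ : ℝ) • triangularVec₁ a + (j₀ : ℝ) • triangularVec₂ a +
                    (haggLabel s m₀ : ℝ) • barlowOffset a + z m₀ • layerNormal 1) ≤ R →
                ∃ j : Fin N, dist (x N j) (x N i + A (
                  ((i' : ℝ) • triangularVec₁ a + (j' : ℝ) • triangularVec₂ a +
                    (haggLabel s m : ℝ) • barlowOffset a + z m • layerNormal 1) -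
                  ((i₀ : ℝ) • triangularVec₁ a + (j₀ : ℝ) • triangularVec₂ a +
                    (haggLabel s m₀ : ℝ) • barlowOffset a + z m₀ • layerNormal 1))) ≤ ε) ∧
              (∀ j : Fin N, dist (x N j) (x N i) ≤ R → ∃ m i' j' : ℤ,
                dist (x N j) (x N i + A (
                  ((i' : ℝ) • triangularVec₁ a + (j' : ℝ) • triangularVec₂ a +
                    (haggLabel s m : ℝ) • barlowOffset a + z m • layerNormal 1) -
                  ((i₀ : ℝ) • triangularVec₁ a + (j₀ : ℝ) • triangularVec₂ a +
                    (haggLabel s m₀ : ℝ) • barlowOffset a + z m₀ • layerNormal 1))) ≤ ε))} : ℝ) / N)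
          Filter.atTop (nhds 0) := by
  sorry

/-- Stub (card B, UNIFORM SPACING = the hidden SELECTION half; XL): for every sequence of
Lennard-Jones ground states in which, for every `D`, a.e. site has an all-Good `D`-ball and, for
every `(R, ε)`, a.e. window is relaxed-layered-matched, a.e. window is matched to a UNIFORM-gap
Barlow template `barlowStacking a h s` (`a, h ∈ (1/2, 2)`) for every `R > 0`, `ε ∈ (0, 1/4)` — i.e.
windows containing stacking disorder with inequivalent / relaxed gaps (faults, `6H`/`9R`-type
contexts; pair-sum obstruction `not_matched_of_gap_jump`) have density `→ 0` in minimisers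
(fault-AREA `o(N)`, Hägg-domination-type selection; kin of `StackingFaultSparsity` stmt-14296). -/
theorem stub_uniformSpacing :
    ∀ x : (N : ℕ) → (Fin N → EuclideanSpace ℝ (Fin 3)),
      (∀ N, IsGroundState lennardJones (x N)) →
      (∀ D : ℝ, 0 < D →
        Filter.Tendsto (fun N : ℕ => (Nat.card {i : Fin N // ¬ (∀ j : Fin N, dist (x N i) (x N j) ≤ D →
          ((∀ j' : Fin N, dist (x N j) (x N j') ≤ 11 / 10 → ∀ k : Fin N, k ≠ j' → (55 : ℝ) / 57 ≤ dist (x N j') (x N k)) ∧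
          (Finset.univ.filter fun j' : Fin N => j' ≠ j ∧ dist (x N j) (x N j') ≤ 1).card = 12 ∧
          (Finset.univ.filter fun j' : Fin N => j' ≠ j ∧ dist (x N j) (x N j') ≤ 11 / 10).card ≤ 12))} : ℝ) / N)
          Filter.atTop (nhds 0)) →
      (∀ R ε : ℝ, 0 < R → 0 < ε → ε < 1 / 4 →
        Filter.Tendsto (fun N : ℕ => (Nat.card {i : Fin N // ¬ (∃ a : ℝ, 47 / 50 ≤ a ∧ a ≤ 1 ∧
          ∃ s : ℤ → ℤ, IsHaggSeq s ∧ ∃ z : ℤ → ℝ,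
            (∀ m : ℤ, 39 / 50 * a ≤ z (m + 1) - z m ∧ z (m + 1) - z m ≤ 17 / 20 * a) ∧
            ∃ m₀ i₀ j₀ : ℤ, ∃ A : EuclideanSpace ℝ (Fin 3) →ₗᵢ[ℝ] EuclideanSpace ℝ (Fin 3),
              (∀ m i' j' : ℤ,
                dist ((i' : ℝ) • triangularVec₁ a + (j' : ℝ) • triangularVec₂ a +
                    (haggLabel s m : ℝ) • barlowOffset a + z m • layerNormal 1)
                  ((i₀ : ℝ) • triangularVec₁ a + (j₀ : ℝ) • triangularVec₂ a +
                    (haggLabel s m₀ : ℝ) • barlowOffset a + z m₀ • layerNormal 1) ≤ R →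
                ∃ j : Fin N, dist (x N j) (x N i + A (
                  ((i' : ℝ) • triangularVec₁ a + (j' : ℝ) • triangularVec₂ a +
                    (haggLabel s m : ℝ) • barlowOffset a + z m • layerNormal 1) -
                  ((i₀ : ℝ) • triangularVec₁ a + (j₀ : ℝ) • triangularVec₂ a +
                    (haggLabel s m₀ : ℝ) • barlowOffset a + z m₀ • layerNormal 1))) ≤ ε) ∧
              (∀ j : Fin N, dist (x N j) (x N i) ≤ R → ∃ m i' j' : ℤ,
                dist (x N j) (x N i + A (
                  ((i' : ℝ) • triangularVec₁ a + (j' : ℝ) • triangularVec₂ a +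
                    (haggLabel s m : ℝ) • barlowOffset a + z m • layerNormal 1) -
                  ((i₀ : ℝ) • triangularVec₁ a + (j₀ : ℝ) • triangularVec₂ a +
                    (haggLabel s m₀ : ℝ) • barlowOffset a + z m₀ • layerNormal 1))) ≤ ε))} : ℝ) / N)
          Filter.atTop (nhds 0)) →
      ∀ R ε : ℝ, 0 < R → 0 < ε → ε < 1 / 4 →
        Filter.Tendsto (fun N : ℕ => (Nat.card {i : Fin N // ¬ (∃ a h : ℝ, 1 / 2 < a ∧ a < 2 ∧ 1 / 2 < h ∧ h < 2 ∧
          ∃ s : ℤ → ℤ, IsHaggSeq s ∧ ∃ z ∈ barlowStacking a h s,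
            ∃ A : EuclideanSpace ℝ (Fin 3) →ₗᵢ[ℝ] EuclideanSpace ℝ (Fin 3),
              (∀ p ∈ barlowStacking a h s, dist p z ≤ R → ∃ j : Fin N, dist (x N j) (x N i + A (p - z)) ≤ ε) ∧
              (∀ j : Fin N, dist (x N j) (x N i) ≤ R →
                ∃ p ∈ barlowStacking a h s, dist (x N j) (x N i + A (p - z)) ≤ ε))} : ℝ) / N)
          Filter.atTop (nhds 0) := by
  sorry

/-- DERIVED (card B): PRICED RIGIDITY — the strain half followed by the selection half. -/
theorem stub_pricedRigidity :
    (∀ (N : ℕ) (x : Fin N → EuclideanSpace ℝ (Fin 3)) (i j : Fin N),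
      (∀ l : Fin N, dist (x i) (x l) ≤ 4 →
        ((∀ j' : Fin N, dist (x l) (x j') ≤ 11 / 10 → ∀ k : Fin N, k ≠ j' →
            (55 : ℝ) / 57 ≤ dist (x j') (x k)) ∧
          (Finset.univ.filter fun j' : Fin N => j' ≠ l ∧ dist (x l) (x j') ≤ 1).card = 12 ∧
          (Finset.univ.filter fun j' : Fin N => j' ≠ l ∧ dist (x l) (x j') ≤ 11 / 10).card ≤ 12)) →
      1 < dist (x i) (x j) → (131 : ℝ) / 100 ≤ dist (x i) (x j)) →
    (∀ (N : ℕ) (x : Fin N → EuclideanSpace ℝ (Fin 3)), Function.Injective x → ∀ S : Finset (Fin N),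
      (S.card : ℝ) * (⨅ Q : PeriodicConfiguration 3, Q.energyPerParticle lennardJones) ≤
        ∑ i ∈ S, ∑ j ∈ S, if i < j then lennardJones (dist (x i) (x j)) else 0) →
    ∀ x : (N : ℕ) → (Fin N → EuclideanSpace ℝ (Fin 3)),
      (∀ N, IsGroundState lennardJones (x N)) →
      (∀ D : ℝ, 0 < D →
        Filter.Tendsto (fun N : ℕ => (Nat.card {i : Fin N // ¬ (∀ j : Fin N, dist (x N i) (x N j) ≤ D →
          ((∀ j' : Fin N, dist (x N j) (x N j') ≤ 11 / 10 → ∀ k : Fin N, k ≠ j' → (55 : ℝ) / 57 ≤ dist (x N j') (x N k)) ∧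
          (Finset.univ.filter fun j' : Fin N => j' ≠ j ∧ dist (x N j) (x N j') ≤ 1).card = 12 ∧
          (Finset.univ.filter fun j' : Fin N => j' ≠ j ∧ dist (x N j) (x N j') ≤ 11 / 10).card ≤ 12))} : ℝ) / N)
          Filter.atTop (nhds 0)) →
      (∀ R : ℝ, 0 < R →
        Filter.Tendsto (fun N : ℕ => (Nat.card {i : Fin N // ∃ j k : Fin N,
          (j ≠ k ∧ dist (x N j) (x N k) ≤ 1 ∧
            (Finset.univ.filter fun l : Fin N =>
              l ≠ j ∧ l ≠ k ∧ dist (x N j) (x N l) ≤ 1 ∧ dist (x N k) (x N l) ≤ 1).card = 5) ∧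
          dist (x N i) (x N j) ≤ R} : ℝ) / N)
          Filter.atTop (nhds 0)) →
      ∀ R ε : ℝ, 0 < R → 0 < ε → ε < 1 / 4 →
        Filter.Tendsto (fun N : ℕ => (Nat.card {i : Fin N // ¬ (∃ a h : ℝ, 1 / 2 < a ∧ a < 2 ∧ 1 / 2 < h ∧ h < 2 ∧
          ∃ s : ℤ → ℤ, IsHaggSeq s ∧ ∃ z ∈ barlowStacking a h s,
            ∃ A : EuclideanSpace ℝ (Fin 3) →ₗᵢ[ℝ] EuclideanSpace ℝ (Fin 3),
              (∀ p ∈ barlowStacking a h s, dist p z ≤ R → ∃ j : Fin N, dist (x N j) (x N i + A (p - z)) ≤ ε) ∧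
              (∀ j : Fin N, dist (x N j) (x N i) ≤ R →
                ∃ p ∈ barlowStacking a h s, dist (x N j) (x N i + A (p - z)) ≤ ε))} : ℝ) / N)
          Filter.atTop (nhds 0) :=
  fun hGap hFloor x hx hD hFF R ε hR hε hε' =>
    stub_uniformSpacing x hx hD (stub_relaxedRigidity hGap hFloor x hx hD hFF) R ε hR hε hε'

/-! ## Composition -/

/-- **The crux from the stubs.**  Localisation turns the a.e.-Good hypothesis into a.e. all-Good
`D`-balls for every `D`; card A (no holes + extended gap + curvature ration, fed the sign lemma)
turns it into a.e. five-fold-free `R`-balls for every `R`; card B (strain half, then selection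
half, fed the extended gap and the floor) converts both, for ground states, into a.e.
Barlow-matched windows. -/
theorem GapTwelveToBarlow_of : GapTwelveToBarlow := by
  intro x hx hGood R ε hR hε hε'
  exact stub_pricedRigidity stub_extendedGap stub_subconfigurationFloor x hx
    (fun D hD => stub_localisation x hGood D hD)
    (fun R' hR' => stub_fiveFoldSparsity stub_noSixCommonNeighbours x hGood R' hR') R ε hR hε hε'

/-- The named predicates are definitionally the clauses appearing in the stubs. -/
example {N : ℕ} (D : ℝ) (x : Fin N → E3) (i : Fin N) :
    AllGoodBall D x i ↔ ∀ j : Fin N, dist (x i) (x j) ≤ D → Good x j := Iff.rfl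

/-- `RelaxedMatched` is definitionally the conclusion clause of `stub_relaxedRigidity`. -/
example {N : ℕ} (R ε : ℝ) (x : Fin N → E3) (i : Fin N) :
    RelaxedMatched R ε x i ↔ ∃ a : ℝ, 47 / 50 ≤ a ∧ a ≤ 1 ∧ ∃ s : ℤ → ℤ, IsHaggSeq s ∧ ∃ z : ℤ → ℝ,
      (∀ m : ℤ, 39 / 50 * a ≤ z (m + 1) - z m ∧ z (m + 1) - z m ≤ 17 / 20 * a) ∧
      ∃ m₀ i₀ j₀ : ℤ, ∃ A : E3 →ₗᵢ[ℝ] E3,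
        (∀ m i' j' : ℤ, dist (layeredPos a s z m i' j') (layeredPos a s z m₀ i₀ j₀) ≤ R →
          ∃ j : Fin N, dist (x j) (x i + A (layeredPos a s z m i' j' - layeredPos a s z m₀ i₀ j₀)) ≤ ε) ∧
        (∀ j : Fin N, dist (x j) (x i) ≤ R → ∃ m i' j' : ℤ,
          dist (x j) (x i + A (layeredPos a s z m i' j' - layeredPos a s z m₀ i₀ j₀)) ≤ ε) := Iff.rfl

end Summit.AtomisticToContinuum.Crystallization.Cruxes.GapTwelveToBarlow.Sketch

end
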